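import Literature.Analysis.FunctionSpaces.TorusClassicalNSDifferenceBalances
import Literature.Analysis.FluidPDE.TorusLinearisedNSH1Balance
import HarnessLib

/-!
# `H¹` and `H → V` continuous dependence for classical Navier–Stokes solutions on the flat torus

Function-space support file (all results proved; no definitions, no named facts), sequel of
`TorusClassicalNSDifferenceBalances.lean` (energy and enstrophy identities for the difference
`w = u₁ − u₂` of two classical solutions with the same viscosity and force) and of
`TorusClassicalNSUniqueness.lean` (`L²` continuous dependence,
`Torus.IsClassicalNSSolutionOn.integral_norm_sub_sq_le_mul_exp`). For two classical solutions on
`[a, a + τ] × T^d` with `‖u₁‖ ≤ M`, `‖∂ᵢu₂‖ ≤ Cᵢ`, `∑ᵢ Cᵢ ≤ Λ`, and `ν > 0`: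

* `Torus.IsClassicalNSSolutionOn.h1_sub_le_mul_exp` — **`H¹` continuous dependence**:
  `∫ ‖w(t)‖² + ‖∇w(t)‖₂² ≤ (∫ ‖w(a)‖² + ‖∇w(a)‖₂²) e^{K'(t − a)}`,
  `K' = 2Λ + (Λ² + |d|M²)/ν` (Temam 1997, Ch. III §6, the `V`-estimates of Lemma 6.1/6.2;
  Robinson–Rodrigo–Sadowski 2016, Thm 6.10-type Grönwall in `H¹`);
* `Torus.IsClassicalNSSolutionOn.sub_mul_gradNormSq_sub_le` — **`H → V` smoothing of
  differences**: `(t − a) ‖∇w(t)‖₂² ≤ C(d, ν, M, Λ, τ) ∫ ‖w(a)‖²`, i.e. the solution map is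
  Lipschitz from `L²`-bounded data into `V` at every later time, uniformly on sets of solutions
  obeying the two coefficient bounds (the nonlinear twin of the `H → V` bound of the first variation
  equation, Constantin–Foias 1988, Ch. 14).

Proof (no time integrals), `E = ∫ ‖w‖²`, `V = ‖∇w‖₂²`, `D = |d|M²`: the balances give
`E' ≤ −2νV + 2ΛE` (`….hasDerivWithinAt_integral_norm_sq_sub`, `Torus.abs_integral_inner_convect_le`)
and `V' ≤ ν⁻¹(D V + Λ² E)` (`….hasDerivWithinAt_gradNormSq_sub`, Young
`Torus.neg_mul_integral_norm_sq_add_integral_inner_le`, `Torus.integral_norm_sq_convect_add_convect_le`);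
Grönwall for `E + V`, and for the smoothing the weighted combination `Φ = (s − a)·½V + κE`,
`κ = (1 + τD/ν)/(4ν)`, whose derivative is at most `βE(s) ≤ βE(a)e^{2Λτ}` (the `V`-terms
cancel), closed by the fencing lemma. Deliberately NOT here: `V → D(A)` estimates, backward bounds.

## Mathlib / tree search

Tree (reused): the two difference balances (`TorusClassicalNSDifferenceBalances`),
`Torus.IsClassicalNSSolutionOn.integral_norm_sub_sq_le_mul_exp` (`TorusClassicalNSUniqueness`),
`Torus.abs_integral_inner_convect_le` (`TorusLinearisedNSEnergy`),
`Torus.neg_mul_integral_norm_sq_add_integral_inner_le` (`FluidPDE/TorusLinearisedNSH1Balance`);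
Mathlib `le_gronwallBound_of_liminf_deriv_right_le`, `image_le_of_deriv_right_le_deriv_boundary`.
Searched `gradNormSq_sub_le`, `h1_sub_le`, `sub.*gradNormSq.*exp`: no `H¹` or smoothing
continuous-dependence statement for classical torus solutions (the linearised twins are
`Torus.linearisedNS_h1_le_mul_exp` and `Torus.linearisedNS_sub_mul_gradNormSq_le`).

## References

* R. Temam, *Infinite-Dimensional Dynamical Systems in Mechanics and Physics*, 2nd ed., Springer
  1997, Ch. III §6.1–6.2 (Lemmas 6.1, 6.2, (6.16)–(6.17)). [Temam1997]
* P. Constantin, C. Foias, *Navier–Stokes Equations*, Univ. Chicago Press 1988, Ch. 13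
  Prop. 13.2, Ch. 14 (14.2)–(14.4). [ConstantinFoiasNSE1988]
-/

open MeasureTheory Set Filter
open scoped InnerProductSpace ContDiff Topology

noncomputable section

namespace Literature.Analysis.FunctionSpaces

namespace Torus

variable {d : Type*} [Fintype d] [DecidableEq d]

variable {a ν M Λ τ : ℝ} {f u₁ u₂ : ℝ → UnitAddTorus d → EuclideanSpace ℝ d} {p₁ p₂ : ℝ → UnitAddTorus d → ℝ}

/-- **The two balance inequalities for the difference `w = u₁ − u₂`** of two classical solutions
on `[a, b] × T^d` (`a < b`, same viscosity `ν > 0` and force) with `‖u₁‖ ≤ M`, `‖∂ᵢu₂‖ ≤ Cᵢ`,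
`∑ᵢ Cᵢ ≤ Λ`: with `E = ∫ ‖w‖²`, `V = ‖∇w‖₂²`, the derivatives `E'`, `V'` of the difference
balances satisfy `E' ≤ −2νV + 2ΛE` and `V' ≤ ν⁻¹ (|d|M² V + Λ² E)` (Temam's `V`-estimates with
(6.17)). [cite: Temam1997, Ch. III §6.2 (6.16)–(6.17)] -/
theorem IsClassicalNSSolutionOn.sub_flux_le {b : ℝ} (hν : 0 < ν)
    (h₁ : IsClassicalNSSolutionOn (Icc a b) ν f u₁ p₁) (h₂ : IsClassicalNSSolutionOn (Icc a b) ν f u₂ p₂)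
    (hM : ∀ t ∈ Icc a b, ∀ x, ‖u₁ t x‖ ≤ M)
    {C : d → ℝ} (hC : ∀ i, ∀ t ∈ Icc a b, ∀ x, ‖partialDeriv i (u₂ t) x‖ ≤ C i) (hCΛ : ∑ i, C i ≤ Λ)
    {t : ℝ} (ht : t ∈ Icc a b) :
    -(2 * ν * gradNormSq (fun y => u₁ t y - u₂ t y)) -
        2 * ∫ x, ⟪convect (fun y => u₁ t y - u₂ t y) (u₂ t) x, u₁ t x - u₂ t x⟫_ℝ ≤
      -(2 * ν) * gradNormSq (fun y => u₁ t y - u₂ t y) + 2 * Λ * ∫ x, ‖u₁ t x - u₂ t x‖ ^ 2 ∧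
    -(2 * ν * ∫ x, ‖laplacian (fun y => u₁ t y - u₂ t y) x‖ ^ 2) +
        2 * ∫ x, ⟪convect (u₁ t) (fun y => u₁ t y - u₂ t y) x +
          convect (fun y => u₁ t y - u₂ t y) (u₂ t) x, laplacian (fun y => u₁ t y - u₂ t y) x⟫_ℝ ≤
      ν⁻¹ * ((Fintype.card d * M ^ 2) * gradNormSq (fun y => u₁ t y - u₂ t y) +
        Λ ^ 2 * ∫ x, ‖u₁ t x - u₂ t x‖ ^ 2) := by
  set w : UnitAddTorus d → EuclideanSpace ℝ d := fun y => u₁ t y - u₂ t y with hw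
  have hu₁ : IsSmooth (u₁ t) := h₁.smooth_velocity.isSmooth_slice ht
  have hu₂ : IsSmooth (u₂ t) := h₂.smooth_velocity.isSmooth_slice ht
  have hws : IsSmooth w := hu₁.sub hu₂
  have hE0 : 0 ≤ ∫ x, ‖u₁ t x - u₂ t x‖ ^ 2 := integral_nonneg fun x => sq_nonneg _
  have hL0 : 0 ≤ ∑ i, C i := Finset.sum_nonneg fun i _ => (norm_nonneg _).trans (hC i t ht 0)
  refine ⟨?_, ?_⟩
  · have h := (abs_le.1 (abs_integral_inner_convect_le hu₂ hws fun i x => hC i t ht x)).1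
    have h2 : (∑ i, C i) * ∫ x, ‖w x‖ ^ 2 ≤ Λ * ∫ x, ‖u₁ t x - u₂ t x‖ ^ 2 :=
      mul_le_mul_of_nonneg_right hCΛ hE0
    have h3 : ∫ x, ‖w x‖ ^ 2 = ∫ x, ‖u₁ t x - u₂ t x‖ ^ 2 := rfl
    rw [h3] at h h2
    linarith
  · have hF : IsSmooth (fun x => convect (u₁ t) w x + convect w (u₂ t) x) :=
      (hu₁.convect hws).add (hws.convect hu₂)
    have hY := Literature.Analysis.FluidPDE.Torus.neg_mul_integral_norm_sq_add_integral_inner_le hν hF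
      hws.laplacian
    have hB := integral_norm_sq_convect_add_convect_le (u₁ := u₁ t) hu₂ hws (hM t ht) fun i x => hC i t ht x
    have h2 : (∑ i, C i) ^ 2 * ∫ x, ‖w x‖ ^ 2 ≤ Λ ^ 2 * ∫ x, ‖u₁ t x - u₂ t x‖ ^ 2 :=
      mul_le_mul_of_nonneg_right (pow_le_pow_left₀ hL0 hCΛ 2) hE0
    have h3 : ∫ x, ‖w x‖ ^ 2 = ∫ x, ‖u₁ t x - u₂ t x‖ ^ 2 := rfl
    rw [h3] at hB h2
    have hν4 : (4 * ν)⁻¹ * (2 * (Fintype.card d * M ^ 2) * gradNormSq w +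
        2 * Λ ^ 2 * ∫ x, ‖u₁ t x - u₂ t x‖ ^ 2) =
        2⁻¹ * (ν⁻¹ * ((Fintype.card d * M ^ 2) * gradNormSq w + Λ ^ 2 * ∫ x, ‖u₁ t x - u₂ t x‖ ^ 2)) := by
      rw [mul_inv]; ring
    have hmono : (4 * ν)⁻¹ * ∫ x, ‖convect (u₁ t) w x + convect w (u₂ t) x‖ ^ 2 ≤
        (4 * ν)⁻¹ * (2 * (Fintype.card d * M ^ 2) * gradNormSq w +
          2 * Λ ^ 2 * ∫ x, ‖u₁ t x - u₂ t x‖ ^ 2) :=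
      mul_le_mul_of_nonneg_left (by linarith) (by positivity)
    rw [hν4] at hmono
    linarith [hY, hmono]

/-- **`H¹` continuous dependence for classical Navier–Stokes solutions on the torus (`ν > 0`).**
For two classical solutions on `[a, b] × T^d` (`a < b`, same viscosity and force) with
`‖u₁‖ ≤ M`, `‖∂ᵢu₂‖ ≤ Cᵢ`, `∑ᵢ Cᵢ ≤ Λ`, `Λ ≥ 0`, the difference `w = u₁ − u₂` obeys
`∫ ‖w(t)‖² + ‖∇w(t)‖₂² ≤ (∫ ‖w(a)‖² + ‖∇w(a)‖₂²) · exp((2Λ + (Λ² + |d|M²)/ν)(t − a))` on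
`[a, b]` (Grönwall for `E + V` with `sub_flux_le`; Temam 1997, Ch. III §6, estimates of
Lemmas 6.1–6.2 in `V`). [cite: Temam1997, Ch. III §6.1 Lemma 6.1 and §6.2 (6.16)–(6.17)] -/
theorem IsClassicalNSSolutionOn.h1_sub_le_mul_exp {b : ℝ} (hν : 0 < ν) (hΛ : 0 ≤ Λ)
    (h₁ : IsClassicalNSSolutionOn (Icc a b) ν f u₁ p₁) (h₂ : IsClassicalNSSolutionOn (Icc a b) ν f u₂ p₂)
    (hab : a < b) (hM : ∀ t ∈ Icc a b, ∀ x, ‖u₁ t x‖ ≤ M)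
    {C : d → ℝ} (hC : ∀ i, ∀ t ∈ Icc a b, ∀ x, ‖partialDeriv i (u₂ t) x‖ ≤ C i) (hCΛ : ∑ i, C i ≤ Λ)
    {t : ℝ} (ht : t ∈ Icc a b) :
    (∫ x, ‖u₁ t x - u₂ t x‖ ^ 2) + gradNormSq (fun y => u₁ t y - u₂ t y) ≤
      ((∫ x, ‖u₁ a x - u₂ a x‖ ^ 2) + gradNormSq (fun y => u₁ a y - u₂ a y)) *
        Real.exp ((2 * Λ + (Λ ^ 2 + Fintype.card d * M ^ 2) / ν) * (t - a)) := by
  set Y : ℝ → ℝ := fun s => (∫ x, ‖u₁ s x - u₂ s x‖ ^ 2) + gradNormSq (fun y => u₁ s y - u₂ s y) with hY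
  set Y' : ℝ → ℝ := fun s =>
    (-(2 * ν * gradNormSq (fun y => u₁ s y - u₂ s y)) -
      2 * ∫ x, ⟪convect (fun y => u₁ s y - u₂ s y) (u₂ s) x, u₁ s x - u₂ s x⟫_ℝ) +
    (-(2 * ν * ∫ x, ‖laplacian (fun y => u₁ s y - u₂ s y) x‖ ^ 2) +
      2 * ∫ x, ⟪convect (u₁ s) (fun y => u₁ s y - u₂ s y) x +
        convect (fun y => u₁ s y - u₂ s y) (u₂ s) x, laplacian (fun y => u₁ s y - u₂ s y) x⟫_ℝ) with hY'
  have hYd : ∀ s ∈ Icc a b, HasDerivWithinAt Y (Y' s) (Icc a b) s := fun s hs =>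
    (h₁.hasDerivWithinAt_integral_norm_sq_sub h₂ hab hs).add (h₁.hasDerivWithinAt_gradNormSq_sub h₂ hab hs)
  have hY'le : ∀ s ∈ Icc a b, Y' s ≤ (2 * Λ + (Λ ^ 2 + Fintype.card d * M ^ 2) / ν) * Y s := by
    intro s hs
    obtain ⟨hE, hV⟩ := h₁.sub_flux_le hν h₂ hM hC hCΛ hs
    have hE0 : 0 ≤ ∫ x, ‖u₁ s x - u₂ s x‖ ^ 2 := integral_nonneg fun x => sq_nonneg _
    have hG0 : 0 ≤ gradNormSq (fun y => u₁ s y - u₂ s y) := gradNormSq_nonneg _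
    have hr0 : 0 ≤ ν⁻¹ := inv_nonneg.2 hν.le
    have hM2 : 0 ≤ (Fintype.card d : ℝ) * M ^ 2 := by positivity
    simp only [hY', hY, div_eq_mul_inv]
    nlinarith [hE, hV, mul_nonneg (mul_nonneg zero_le_two hΛ) hG0, mul_nonneg hν.le hG0,
      mul_nonneg (mul_nonneg hM2 hr0) hE0, mul_nonneg (mul_nonneg (sq_nonneg Λ) hr0) hG0]
  have hYc : ContinuousOn Y (Icc a b) := fun s hs => (hYd s hs).continuousWithinAt
  have hder : ∀ s ∈ Ico a b, HasDerivWithinAt Y (Y' s) (Ici s) s := fun s hs =>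
    ((hYd s (Ico_subset_Icc_self hs)).mono (Icc_subset_Icc hs.1 le_rfl)).mono_of_mem_nhdsWithin
      (Icc_mem_nhdsGE hs.2)
  have hgr := le_gronwallBound_of_liminf_deriv_right_le (f := Y) (f' := Y') (δ := Y a)
    (K := 2 * Λ + (Λ ^ 2 + Fintype.card d * M ^ 2) / ν) (ε := 0) (a := a) (b := b) hYc
    (fun s hs r hr => (hder s hs).liminf_right_slope_le hr) le_rfl
    (fun s hs => by
      rw [add_zero]
      exact hY'le s (Ico_subset_Icc_self hs)) t ht
  rwa [gronwallBound_ε0] at hgr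

/-- **`H → V` smoothing of differences of classical Navier–Stokes solutions on the torus.** For
`ν > 0`, bounds `M`, `Λ ≥ 0` and a time lapse `τ > 0` put `D = |d|M²`, `κ = (1 + τD/ν)/(4ν)`,
`β = τΛ²/(2ν) + 2κΛ`, `C = 2(κ + βτe^{2Λτ})`. For two classical solutions on `[a, a + τ] × T^d`
(same viscosity and force) with `‖u₁‖ ≤ M`, `‖∂ᵢu₂‖ ≤ Cᵢ`, `∑ᵢ Cᵢ ≤ Λ`, the difference
`w = u₁ − u₂` obeys `(t − a) ‖∇w(t)‖₂² ≤ C ∫ ‖w(a)‖²` for `t ∈ [a, a + τ]`: the nonlinear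
solution map is Lipschitz from `L²`-close data into `V` at every later time, with a constant
depending on the two solutions only through `M`, `Λ` (the nonlinear twin of the `H → V` bound of
the first variation equation, Constantin–Foias 1988, Ch. 14 after (14.4)). [folklore] -/
theorem IsClassicalNSSolutionOn.sub_mul_gradNormSq_sub_le (hν : 0 < ν) (hΛ : 0 ≤ Λ) (hτ : 0 < τ)
    (h₁ : IsClassicalNSSolutionOn (Icc a (a + τ)) ν f u₁ p₁)
    (h₂ : IsClassicalNSSolutionOn (Icc a (a + τ)) ν f u₂ p₂)
    (hM : ∀ t ∈ Icc a (a + τ), ∀ x, ‖u₁ t x‖ ≤ M)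
    {C : d → ℝ} (hC : ∀ i, ∀ t ∈ Icc a (a + τ), ∀ x, ‖partialDeriv i (u₂ t) x‖ ≤ C i)
    (hCΛ : ∑ i, C i ≤ Λ) {t : ℝ} (ht : t ∈ Icc a (a + τ)) :
    (t - a) * gradNormSq (fun y => u₁ t y - u₂ t y) ≤
      2 * ((1 + τ * (Fintype.card d * M ^ 2) / ν) / (4 * ν) +
        (τ * Λ ^ 2 / (2 * ν) + 2 * ((1 + τ * (Fintype.card d * M ^ 2) / ν) / (4 * ν)) * Λ) *
          τ * Real.exp (2 * Λ * τ)) * ∫ x, ‖u₁ a x - u₂ a x‖ ^ 2 := by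
  set b : ℝ := a + τ with hb
  have hab : a < b := by rw [hb]; linarith
  have ha : a ∈ Icc a b := left_mem_Icc.2 hab.le
  have hν0 : ν ≠ 0 := hν.ne'
  set D : ℝ := Fintype.card d * M ^ 2 with hD
  have hD0 : 0 ≤ D := by positivity
  set κ : ℝ := (1 + τ * D / ν) / (4 * ν) with hκ
  have hκ0 : 0 ≤ κ := by positivity
  set β : ℝ := τ * Λ ^ 2 / (2 * ν) + 2 * κ * Λ with hβ
  have hβ0 : 0 ≤ β := by positivity
  set E : ℝ → ℝ := fun s => ∫ x, ‖u₁ s x - u₂ s x‖ ^ 2 with hE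
  set G : ℝ → ℝ := fun s => gradNormSq (fun y => u₁ s y - u₂ s y) with hG
  have hE0 : ∀ s, 0 ≤ E s := fun s => integral_nonneg fun x => sq_nonneg _
  have hG0 : ∀ s, 0 ≤ G s := fun s => gradNormSq_nonneg _
  set E' : ℝ → ℝ := fun s => -(2 * ν * gradNormSq (fun y => u₁ s y - u₂ s y)) -
    2 * ∫ x, ⟪convect (fun y => u₁ s y - u₂ s y) (u₂ s) x, u₁ s x - u₂ s x⟫_ℝ with hE'
  set G' : ℝ → ℝ := fun s => -(2 * ν * ∫ x, ‖laplacian (fun y => u₁ s y - u₂ s y) x‖ ^ 2) +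
    2 * ∫ x, ⟪convect (u₁ s) (fun y => u₁ s y - u₂ s y) x +
      convect (fun y => u₁ s y - u₂ s y) (u₂ s) x, laplacian (fun y => u₁ s y - u₂ s y) x⟫_ℝ with hG'
  have hdE : ∀ s ∈ Icc a b, HasDerivWithinAt E (E' s) (Icc a b) s := fun s hs =>
    h₁.hasDerivWithinAt_integral_norm_sq_sub h₂ hab hs
  have hdG : ∀ s ∈ Icc a b, HasDerivWithinAt G (G' s) (Icc a b) s := fun s hs =>
    h₁.hasDerivWithinAt_gradNormSq_sub h₂ hab hs
  have hflux : ∀ s ∈ Icc a b, E' s ≤ -(2 * ν) * G s + 2 * Λ * E s ∧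
      G' s ≤ ν⁻¹ * (D * G s + Λ ^ 2 * E s) := fun s hs => h₁.sub_flux_le hν h₂ hM hC hCΛ hs
  -- Grönwall bound for `E`
  have hEexp : ∀ s ∈ Icc a b, E s ≤ E a * Real.exp (2 * Λ * τ) := by
    intro s hs
    have h := h₁.integral_norm_sub_sq_le_mul_exp hν.le h₂ hab hC hs
    refine h.trans (mul_le_mul_of_nonneg_left (Real.exp_le_exp.2 ?_) (hE0 a))
    have habs : ∑ i, |C i| = ∑ i, C i :=
      Finset.sum_congr rfl fun i _ => abs_of_nonneg ((norm_nonneg _).trans (hC i a ha 0))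
    have h1 : s - a ≤ τ := by rw [hb] at hs; linarith [hs.2]
    have h2 : 0 ≤ s - a := by linarith [hs.1]
    rw [habs]
    calc 2 * (∑ i, C i) * (s - a) ≤ 2 * Λ * (s - a) := by gcongr
      _ ≤ 2 * Λ * τ := by gcongr
  -- the weighted combination `Φ(s) = (s - a) · ½G(s) + κ E(s)`
  set γ : ℝ := β * (E a * Real.exp (2 * Λ * τ)) with hγ
  set Φ : ℝ → ℝ := fun s => (s - a) * (2⁻¹ * G s) + κ * E s with hΦ
  set Φ' : ℝ → ℝ := fun s => (1 * (2⁻¹ * G s) + (s - a) * (2⁻¹ * G' s)) + κ * E' s with hΦ'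
  have hdΦ : ∀ s ∈ Icc a b, HasDerivWithinAt Φ (Φ' s) (Icc a b) s := by
    intro s hs
    have h1 : HasDerivWithinAt (fun r => r - a) 1 (Icc a b) s := by
      have h := (hasDerivWithinAt_id s (Icc a b)).sub (hasDerivWithinAt_const s (Icc a b) a)
      rw [sub_zero] at h
      exact h
    exact (h1.mul ((hdG s hs).const_mul 2⁻¹)).add ((hdE s hs).const_mul κ)
  have hΦ'le : ∀ s ∈ Icc a b, Φ' s ≤ γ := by
    intro s hs
    have hs1 : 0 ≤ s - a := by linarith [hs.1]
    have hs2 : s - a ≤ τ := by rw [hb] at hs; linarith [hs.2]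
    have hGs := hG0 s
    have hEs := hE0 s
    obtain ⟨h2, h1⟩ := hflux s hs
    have h3 : (s - a) * (2⁻¹ * G' s) ≤ τ * ((2 * ν)⁻¹ * (D * G s + Λ ^ 2 * E s)) := by
      have hR : 0 ≤ (2 * ν)⁻¹ * (D * G s + Λ ^ 2 * E s) := by positivity
      have h1' : 2⁻¹ * G' s ≤ (2 * ν)⁻¹ * (D * G s + Λ ^ 2 * E s) := by
        rw [mul_inv]; nlinarith [h1]
      calc (s - a) * (2⁻¹ * G' s) ≤ (s - a) * ((2 * ν)⁻¹ * (D * G s + Λ ^ 2 * E s)) :=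
            mul_le_mul_of_nonneg_left h1' hs1
        _ ≤ τ * ((2 * ν)⁻¹ * (D * G s + Λ ^ 2 * E s)) := mul_le_mul_of_nonneg_right hs2 hR
    have h4 : κ * E' s ≤ κ * (-(2 * ν) * G s + 2 * Λ * E s) := mul_le_mul_of_nonneg_left h2 hκ0
    have hcoef : 2⁻¹ + τ * ((2 * ν)⁻¹ * D) - κ * (2 * ν) = 0 := by
      rw [hκ]; field_simp; ring
    have hcoefE : τ * ((2 * ν)⁻¹ * Λ ^ 2) + κ * (2 * Λ) = β := by
      rw [hβ]; field_simp
    have h5 := hEexp s hs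
    calc Φ' s = 2⁻¹ * G s + (s - a) * (2⁻¹ * G' s) + κ * E' s := by simp only [hΦ', one_mul]
      _ ≤ 2⁻¹ * G s + τ * ((2 * ν)⁻¹ * (D * G s + Λ ^ 2 * E s)) + κ * (-(2 * ν) * G s + 2 * Λ * E s) := by
          linarith [h3, h4]
      _ = (2⁻¹ + τ * ((2 * ν)⁻¹ * D) - κ * (2 * ν)) * G s + (τ * ((2 * ν)⁻¹ * Λ ^ 2) + κ * (2 * Λ)) * E s := by
          ring
      _ = β * E s := by rw [hcoef, hcoefE, zero_mul, zero_add]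
      _ ≤ γ := mul_le_mul_of_nonneg_left h5 hβ0
  -- fencing on `[a, b]`
  have hΦc : ContinuousOn Φ (Icc a b) := fun s hs => (hdΦ s hs).continuousWithinAt
  have hΦr : ∀ s ∈ Ico a b, HasDerivWithinAt Φ (Φ' s) (Ici s) s := fun s hs =>
    ((hdΦ s (Ico_subset_Icc_self hs)).mono (Icc_subset_Icc hs.1 le_rfl)).mono_of_mem_nhdsWithin
      (Icc_mem_nhdsGE hs.2)
  have hfence := image_le_of_deriv_right_le_deriv_boundary hΦc hΦr
    (B := fun s => Φ a + γ * (s - a)) (B' := fun _ => γ) (by simp) (by fun_prop)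
    (fun s _ => by
      have h1 : HasDerivWithinAt (fun r => Φ a + γ * (r - a)) (0 + γ * (1 - 0)) (Ici s) s :=
        (hasDerivWithinAt_const _ _ _).add (((hasDerivWithinAt_id _ _).sub
          (hasDerivWithinAt_const _ _ _)).const_mul γ)
      simpa using h1)
    (fun s hs => hΦ'le s (Ico_subset_Icc_self hs)) ht
  have hfence' : Φ t ≤ Φ a + γ * (t - a) := hfence
  -- unwind
  have hΦa : Φ a = κ * E a := by simp only [hΦ, sub_self, zero_mul, zero_add]
  have ht2 : t - a ≤ τ := by rw [hb] at ht; linarith [ht.2]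
  have hγ0 : 0 ≤ γ := by positivity
  have hlow : (t - a) * (2⁻¹ * G t) ≤ Φ t := le_add_of_nonneg_right (mul_nonneg hκ0 (hE0 t))
  have hγt : γ * (t - a) ≤ γ * τ := mul_le_mul_of_nonneg_left ht2 hγ0
  have hfin : (t - a) * (2⁻¹ * G t) ≤ κ * E a + β * (E a * Real.exp (2 * Λ * τ)) * τ := by
    linarith [hlow, hfence', hΦa, hγt]
  nlinarith [hfin]

end Torus

end Literature.Analysis.FunctionSpaces

end
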